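import Summits.CriticalPhenomena.PercolationContinuityZ3.Theorems.Transplant.PlanarSkeletonFrmQuasiDefs
import Summits.CriticalPhenomena.PercolationContinuityZ3.Theorems.Transplant.SkelFrmQuasiBChoiceRootLanding
import Summits.CriticalPhenomena.PercolationContinuityZ3.Theorems.Transplant.SkelFrmBChoiceRootLanding
import Summits.CriticalPhenomena.PercolationContinuityZ3.Theorems.Transplant.SkelFrmQuasiBParamsCorrKGLen3
import Summits.CriticalPhenomena.PercolationContinuityZ3.Theorems.Transplant.SkelFrmBParamsCorrKGLen3
import Summits.CriticalPhenomena.PercolationContinuityZ3.Theorems.Transplant.SkelFrmQuasiBParamsCorrKGLenY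
import Summits.CriticalPhenomena.PercolationContinuityZ3.Theorems.Transplant.SkelFrmBParamsCorrKGLenY
import Summits.CriticalPhenomena.PercolationContinuityZ3.Theorems.Transplant.SkelFrmQuasiBChoiceReadNums
import Summits.CriticalPhenomena.PercolationContinuityZ3.Theorems.Transplant.SkelFrmBChoiceReadNums
import Summits.CriticalPhenomena.PercolationContinuityZ3.Theorems.Transplant.SkelPhiCorridorKGYMonoW
import Summits.CriticalPhenomena.PercolationContinuityZ3.Theorems.Transplant.SkelFrmQuasi1ChoiceDefs
import Summits.CriticalPhenomena.PercolationContinuityZ3.Theorems.Transplant.SkelFrmQuasi1ParamsLBL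
import Summits.CriticalPhenomena.PercolationContinuityZ3.Theorems.Transplant.SkelFrmQuasiBChoiceNums
import Summits.CriticalPhenomena.PercolationContinuityZ3.Theorems.Transplant.SkelFrmQuasiBParamsCorrKG
import Summits.CriticalPhenomena.PercolationContinuityZ3.Theorems.Transplant.SkelFrmQuasiBParamsCorrKG0
import Summits.CriticalPhenomena.PercolationContinuityZ3.Theorems.Transplant.SkelFrmQuasiBParamsCorrKGY
import Summits.CriticalPhenomena.PercolationContinuityZ3.Theorems.Transplant.SkelFrmQuasiBParamsLF
import HarnessLib
import Summits.CriticalPhenomena.PercolationContinuityZ3.Theorems.Transplant.SkelFrmBChoiceRootRunY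
/-!
# GEN-Q PORT (WAVE-Q table v0.8 section 2, row G129, U-level L16; captain R-6/R-7 2026-08-27: carrier token swap `PlanarSkeletonFrmFrom ↦ PlanarSkeletonFrmQuasi`)
# of the tree module «Transplant/SkelFrmFromBChoiceRootRunY» (sha256 78829da7e337dee3…) onto the quasi-step carrier `PlanarSkeletonFrmQuasi` (p507026): «SkelFrmQuasiBChoiceRootRunY»

ORIGINAL TITLE: N2 (frames-only node `SamePDropOfSkeletonFrm₁`, OPEN), (R) column SECOND axis — **(R-46): THE ROOT'S y′-CORRIDOR ORIGIN AND ACROSS WINDOW**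

builds on p205010 (kernel theorem, internal audit signed; external expert review pending) — nothing in this file uses p205010; NOTHING is claimed about any open node
((N3-b), the end state).  Lane `prim-bschramm`, seat `prim-hp-8` (gen 62; GEN-Q pen, family BChoiceRoot*/1Root*/BParamsKit·Bridge; tool = captain gen-1 g4's port_genq.py R-14 + p3-g30 T1/T2 + stmt-g33 --force-keep).  Helper file (`--supports stmt-CriticalPhenomena-4575 --as helper`).
PORT RULES (U-wave r1–r4 re-used, GEN-Q hunk classes of p3-g29 #6136): declaration order, names and proof texts are those of «SkelFrmFromBChoiceRootRunY», byte-identical except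
(i) the carrier token `PlanarSkeletonFrmFrom ↦ PlanarSkeletonFrmQuasi` in binders, `namespace`/`end` lines and qualified names (module names `SkelFrmFrom… ↦ SkelFrmQuasi…`
in imports of already-ported rows); (ii) `Φ.step ↦ Φ.qstep` with the called Steps lemma replaced by its `…Q`/`_q` twin and the cost `Φ.M` threaded (none in this file unless
listed below); (iii) `Φ.cyl_connected ↦ Φ.cyl_reach` readers (none unless listed); (iv) graph-ball radii / window floors ×`Φ.M`: HAND HUNK (hunk ii/iv, landing radius) — `exists_landing2` takes `{Mq} (hq : Skelφ.QStepsN G ψ Mq)`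
for `(hstep : Skelφ.Steps G ψ)` and lands within `Mq · D2R` (was `D2R`), via `Skelφ.QStepsN.exists_mem_graphBall_eq`; the readers («SkelFrmQuasi1RootHoldsQ·KVOfLePx») pass `Φ.qstep`
and floor the landing radius ×`Φ.M`.  HAND HUNK (L-KitS-1 / L-FLOORMAP-1 ⑧): the kit's R′ is read at the window cost of
record — `KS0.R'0 κ Φ t p D mk ↦ KS0.R'0N κ Φ (KS.NQ Φ) t p D mk` (stmt-g33's G017 «SkelFrmQuasiBChoiceNums», hp-8's «SkelFrmQuasiBParamsKitSN»).  Carrier-free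
residents stay imported/exported from the original «SkelFrmBChoiceRootRunY» exactly as in the FrmFrom port.  Docstrings and citations are the original's.

-/

noncomputable section

open scoped Classical

namespace Summit.CriticalPhenomena.PercolationContinuityZ3.Theorems.Transplant

namespace PlanarSkeletonFrmQuasi

namespace NegB

open Literature.Probability.Percolation Literature.Probability.LatticeModels SimpleGraph
open Literature.Barriers.CriticalPhenomena (graphBall)
open SkelConc (Consts)
open Skelφ (shearUnit kgSL kgSLY kgP kgΔY kgNY KGYRows kgFarY kgXY kgM₁Y kgM₂Y kgT₁Y kgWm₂Y kgWp₂Y kgZY₀ kgZY₁ kgCtr2Y kgHw2Y kgDec₁Y)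
open Neg

namespace KS

/-! ## §1 The origin offset, the root's across residual, the shear-line height -/

section Defs

variable (κ : Consts) {V : Type} [DecidableEq V] [Countable V] {G : SimpleGraph V} [G.LocallyFinite] (Φ : PlanarSkeletonFrmQuasi G) (t : V) (p : unitInterval)
  (D : Skelφ.StepI.DataNS V) (mk g f WxY : ℕ)

/-- **The root's y′-origin x-offset** `X2R := ⌊(WxY + Rs + 34·n_L + 29·R′0)/2⌋ + 1` (`k₀ := 28`: `34 = k₀ + 6`, `29 = k₀ + 1`). [this work] -/
def X2R (κ : Consts) {V : Type} [DecidableEq V] [Countable V] {G : SimpleGraph V} [G.LocallyFinite] (Φ : PlanarSkeletonFrmQuasi G) (t : V) (p : unitInterval) (D : Skelφ.StepI.DataNS V) (mk : ℕ) (g : ℕ) (f : ℕ) (WxY : ℕ) : ℕ := (WxY + KS.Rs t D mk + 34 * nL κ Φ t p D g f + 29 * KS0.R'0N κ Φ (KS.NQ Φ) t p D mk) / 2 + 1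

/-- **The root's across residual** `WxYR := WxY − X2R` (so `kgWY WxYR = W_Y − X2R`). [this work] -/
def WxYR (κ : Consts) {V : Type} [DecidableEq V] [Countable V] {G : SimpleGraph V} [G.LocallyFinite] (Φ : PlanarSkeletonFrmQuasi G) (t : V) (p : unitInterval) (D : Skelφ.StepI.DataNS V) (mk : ℕ) (g : ℕ) (f : ℕ) (WxY : ℕ) : ℕ := WxY - X2R κ Φ t p D mk g f WxY

/-- **The root's y′-origin height** `Y2R := ⌈h_L·X2R/n_L⌉` (the origin sits on the shear line through `t`: `0 ≤ n_L·Y2R − h_L·X2R < n_L`). [this work] -/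
def Y2R (κ : Consts) {V : Type} [DecidableEq V] [Countable V] {G : SimpleGraph V} [G.LocallyFinite] (Φ : PlanarSkeletonFrmQuasi G) (t : V) (p : unitInterval) (D : Skelφ.StepI.DataNS V) (mk : ℕ) (g : ℕ) (f : ℕ) (WxY : ℕ) : ℤ := -((-(hL κ Φ t p D g f * (X2R κ Φ t p D mk g f WxY : ℤ))) / (nL κ Φ t p D g f : ℤ))

/-- The origin's `ℓ₁` depth `D2R := X2R + |Y2R|`. [this work] -/
def D2R (κ : Consts) {V : Type} [DecidableEq V] [Countable V] {G : SimpleGraph V} [G.LocallyFinite] (Φ : PlanarSkeletonFrmQuasi G) (t : V) (p : unitInterval) (D : Skelφ.StepI.DataNS V) (mk : ℕ) (g : ℕ) (f : ℕ) (WxY : ℕ) : ℕ := X2R κ Φ t p D mk g f WxY + (Y2R κ Φ t p D mk g f WxY).natAbs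

end Defs

/-! ## §2 Rows about the origin -/

section Rows

variable (κ : Consts) {V : Type} [DecidableEq V] [Countable V] {G : SimpleGraph V} [G.LocallyFinite] (Φ : PlanarSkeletonFrmQuasi G) (t : V) (p : unitInterval)
  (D : Skelφ.StepI.DataNS V) (mk g f qxY WxY : ℕ)

/-- `X2R ≤ WxY` under the floor, hence **`X2R + WxYR = WxY`** and `kgWY WxYR + X2R = kgWY WxY` (same core-0 east edge). [folklore] -/
theorem X2R_add_WxYR (κ : Consts) {V : Type} [DecidableEq V] [Countable V] {G : SimpleGraph V} [G.LocallyFinite] (Φ : PlanarSkeletonFrmQuasi G) (t : V) (p : unitInterval) (D : Skelφ.StepI.DataNS V) (mk : ℕ) (g : ℕ) (f : ℕ) (WxY : ℕ) (hWxY : KS.Rs t D mk + 34 * nL κ Φ t p D g f + 29 * KS0.R'0N κ Φ (KS.NQ Φ) t p D mk + 2 ≤ WxY) :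
    (KS.X2R κ Φ t p D mk g f WxY) + (KS.WxYR κ Φ t p D mk g f WxY) = WxY ∧ (((kgWY κ Φ t p D g f (KS.WxYR κ Φ t p D mk g f WxY)) : ℕ) : ℤ) + (KS.X2R κ Φ t p D mk g f WxY) = (kgWY κ Φ t p D g f WxY) := by
  have hle : (KS.X2R κ Φ t p D mk g f WxY) ≤ WxY := by
    unfold KS.X2R; omega
  have h1 : (KS.X2R κ Φ t p D mk g f WxY) + (KS.WxYR κ Φ t p D mk g f WxY) = WxY := by unfold KS.WxYR; omega
  refine ⟨h1, ?_⟩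
  unfold kgWY
  have : 2 * (nL κ Φ t p D g f) + (KS.WxYR κ Φ t p D mk g f WxY) + (KS.X2R κ Φ t p D mk g f WxY) = 2 * (nL κ Φ t p D g f) + WxY := by omega
  exact_mod_cast this

/-- **The origin sits on the shear line**: `0 ≤ n_L·Y2R − h_L·X2R < n_L`, so `⌊(n_L·Y2R − h_L·X2R)/U⌋ = 0` for `U = n_L + |h_L|`. [folklore] -/
theorem rows_c₂_zero (κ : Consts) {V : Type} [DecidableEq V] [Countable V] {G : SimpleGraph V} [G.LocallyFinite] (Φ : PlanarSkeletonFrmQuasi G) (t : V) (p : unitInterval) (D : Skelφ.StepI.DataNS V) (mk : ℕ) (g : ℕ) (f : ℕ) (WxY : ℕ) (hN : EqNumL κ Φ t p D g f) :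
    0 ≤ (nL κ Φ t p D g f : ℤ) * (KS.Y2R κ Φ t p D mk g f WxY) - (hL κ Φ t p D g f) * ((KS.X2R κ Φ t p D mk g f WxY) : ℤ) ∧ (nL κ Φ t p D g f : ℤ) * (KS.Y2R κ Φ t p D mk g f WxY) - (hL κ Φ t p D g f) * ((KS.X2R κ Φ t p D mk g f WxY) : ℤ) < (nL κ Φ t p D g f : ℤ) ∧
      ((nL κ Φ t p D g f : ℤ) * (KS.Y2R κ Φ t p D mk g f WxY) - (hL κ Φ t p D g f) * ((KS.X2R κ Φ t p D mk g f WxY) : ℤ)) / (shearUnit (nL κ Φ t p D g f) (hL κ Φ t p D g f) : ℤ) = 0 := by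
  have hn1 : (1 : ℤ) ≤ (nL κ Φ t p D g f : ℤ) := by exact_mod_cast (one_le_of_eqNumL κ Φ t p D g f hN).1
  have hn0 : (0 : ℤ) < (nL κ Φ t p D g f : ℤ) := by linarith
  have hY : (KS.Y2R κ Φ t p D mk g f WxY) = -((-((hL κ Φ t p D g f) * ((KS.X2R κ Φ t p D mk g f WxY) : ℤ))) / (nL κ Φ t p D g f : ℤ)) := rfl
  have h1 := Int.ediv_mul_le (-((hL κ Φ t p D g f) * ((KS.X2R κ Φ t p D mk g f WxY) : ℤ))) (ne_of_gt hn0)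
  have h2 := Int.lt_ediv_add_one_mul_self (-((hL κ Φ t p D g f) * ((KS.X2R κ Φ t p D mk g f WxY) : ℤ))) hn0
  have hlo : 0 ≤ (nL κ Φ t p D g f : ℤ) * (KS.Y2R κ Φ t p D mk g f WxY) - (hL κ Φ t p D g f) * ((KS.X2R κ Φ t p D mk g f WxY) : ℤ) := by rw [hY]; nlinarith
  have hhi : (nL κ Φ t p D g f : ℤ) * (KS.Y2R κ Φ t p D mk g f WxY) - (hL κ Φ t p D g f) * ((KS.X2R κ Φ t p D mk g f WxY) : ℤ) < (nL κ Φ t p D g f : ℤ) := by rw [hY]; nlinarith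
  refine ⟨hlo, hhi, ?_⟩
  have hU : (nL κ Φ t p D g f : ℤ) ≤ (shearUnit (nL κ Φ t p D g f) (hL κ Φ t p D g f) : ℤ) := by
    unfold shearUnit; push_cast
    have := abs_nonneg (hL κ Φ t p D g f)
    have : (((hL κ Φ t p D g f)).natAbs : ℤ) = |(hL κ Φ t p D g f)| := Int.natCast_natAbs _
    linarith
  exact Int.ediv_eq_zero_of_lt hlo (lt_of_lt_of_le hhi hU)

/-- **THE ORIGIN VERTEX EXISTS** (any planar map with unit steps): `c₂ ∈ B_G(t, D2R)` with `ψ c₂ − ψ t = (X2R, Y2R)`. [folklore] -/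
theorem exists_landing2 (κ : Consts) {V : Type} [DecidableEq V] [Countable V] {G : SimpleGraph V} [G.LocallyFinite] (Φ : PlanarSkeletonFrmQuasi G) (t : V) (p : unitInterval) (D : Skelφ.StepI.DataNS V) (mk : ℕ) (g : ℕ) (f : ℕ) (WxY : ℕ) {ψ : V → Site 2} {Mq : ℕ} (hq : Skelφ.QStepsN G ψ Mq) :
    ∃ c₂, c₂ ∈ graphBall G t (Mq * D2R κ Φ t p D mk g f WxY) ∧ ψ c₂ 0 - ψ t 0 = (((KS.X2R κ Φ t p D mk g f WxY) : ℕ) : ℤ) ∧ ψ c₂ 1 - ψ t 1 = (KS.Y2R κ Φ t p D mk g f WxY) := by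
  obtain ⟨c₂, hc, hy⟩ := Skelφ.QStepsN.exists_mem_graphBall_eq hq t (ψ t + Skelφ.pt (((KS.X2R κ Φ t p D mk g f WxY) : ℕ) : ℤ) (KS.Y2R κ Φ t p D mk g f WxY))
  have e0 : (ψ t + Skelφ.pt (((KS.X2R κ Φ t p D mk g f WxY) : ℕ) : ℤ) (KS.Y2R κ Φ t p D mk g f WxY)) 0 - ψ t 0 = (((KS.X2R κ Φ t p D mk g f WxY) : ℕ) : ℤ) := by simp
  have e1 : (ψ t + Skelφ.pt (((KS.X2R κ Φ t p D mk g f WxY) : ℕ) : ℤ) (KS.Y2R κ Φ t p D mk g f WxY)) 1 - ψ t 1 = (KS.Y2R κ Φ t p D mk g f WxY) := by simp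
  rw [e0, e1] at hc
  have hD : ((((KS.X2R κ Φ t p D mk g f WxY) : ℕ) : ℤ)).natAbs + ((KS.Y2R κ Φ t p D mk g f WxY)).natAbs = D2R κ Φ t p D mk g f WxY := by unfold KS.D2R; simp
  rw [hD] at hc
  refine ⟨c₂, hc, ?_, ?_⟩
  · have := congrFun hy 0; simp only [Pi.add_apply, Skelφ.pt_zero] at this; linarith
  · have := congrFun hy 1; simp only [Pi.add_apply, Skelφ.pt_one] at this; linarith

/-- **EAST CLEARANCE OF THE LOW RUN REGIONS** (p358645 `clear_of_kgCorrSchedY_rows` / its square-avoidance successor, hypothesis `hxrow`, at `k₀ := 28`): for every `k ≤ 28`,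
`Rs < k·v_L − ((n_L + v_L)⁺ + W^R) − (k+1)·R′0 − n_L + X2R` (margin `n_L`). [this work] -/
theorem hxrow_R (κ : Consts) {V : Type} [DecidableEq V] [Countable V] {G : SimpleGraph V} [G.LocallyFinite] (Φ : PlanarSkeletonFrmQuasi G) (t : V) (p : unitInterval) (D : Skelφ.StepI.DataNS V) (mk : ℕ) (g : ℕ) (f : ℕ) (WxY : ℕ) (hN : EqNumL κ Φ t p D g f) (hWxY : KS.Rs t D mk + 34 * nL κ Φ t p D g f + 29 * KS0.R'0N κ Φ (KS.NQ Φ) t p D mk + 2 ≤ WxY) :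
    ∀ k : ℕ, k ≤ 28 → (((KS.Rs t D mk) : ℕ) : ℤ) < (k : ℤ) * (vL κ Φ t p D g f) - ((((nL κ Φ t p D g f) + (vL κ Φ t p D g f)).toNat + (kgWY κ Φ t p D g f (KS.WxYR κ Φ t p D mk g f WxY)) : ℕ) : ℤ) - ((k : ℤ) + 1) * (((KS0.R'0N κ Φ (KS.NQ Φ) t p D mk) : ℕ) : ℤ) - (nL κ Φ t p D g f : ℤ) +
      (((KS.X2R κ Φ t p D mk g f WxY) : ℕ) : ℤ) := by
  intro k hk
  obtain ⟨-, hsum⟩ := X2R_add_WxYR κ Φ t p D mk g f WxY hWxY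
  have hv := hN.v_le
  have hvn : -(nL κ Φ t p D g f : ℤ) ≤ (vL κ Φ t p D g f) := by have := neg_abs_le (vL κ Φ t p D g f); linarith
  have hk' : (k : ℤ) ≤ 28 := by exact_mod_cast hk
  have hk0 : (0 : ℤ) ≤ k := by positivity
  have hn0 : (0 : ℤ) ≤ (nL κ Φ t p D g f : ℤ) := by positivity
  have hR0 : (0 : ℤ) ≤ (((KS0.R'0N κ Φ (KS.NQ Φ) t p D mk) : ℕ) : ℤ) := by positivity
  have ht : ((((nL κ Φ t p D g f) + (vL κ Φ t p D g f)).toNat : ℕ) : ℤ) ≤ 2 * (nL κ Φ t p D g f : ℤ) := by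
    have h1 : ((((nL κ Φ t p D g f) + (vL κ Φ t p D g f)).toNat : ℕ) : ℤ) = max ((nL κ Φ t p D g f : ℤ) + (vL κ Φ t p D g f)) 0 := Int.toNat_eq_max _
    rw [h1]
    have := le_abs_self (vL κ Φ t p D g f)
    exact max_le (by linarith) (by linarith)
  have hX : (WxY : ℤ) + (KS.Rs t D mk) + 34 * (nL κ Φ t p D g f : ℤ) + 29 * (((KS0.R'0N κ Φ (KS.NQ Φ) t p D mk) : ℕ) : ℤ) + 1 ≤ 2 * (((KS.X2R κ Φ t p D mk g f WxY) : ℕ) : ℤ) := by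
    have : WxY + (KS.Rs t D mk) + 34 * (nL κ Φ t p D g f) + 29 * (KS0.R'0N κ Φ (KS.NQ Φ) t p D mk) + 1 ≤ 2 * (KS.X2R κ Φ t p D mk g f WxY) := by unfold KS.X2R; omega
    exact_mod_cast this
  have hW : (((kgWY κ Φ t p D g f WxY) : ℕ) : ℤ) = 2 * (nL κ Φ t p D g f : ℤ) + WxY := by unfold kgWY; push_cast; ring
  have hkv : -(28 * (nL κ Φ t p D g f : ℤ)) ≤ (k : ℤ) * (vL κ Φ t p D g f) := by nlinarith
  have hkR : ((k : ℤ) + 1) * (((KS0.R'0N κ Φ (KS.NQ Φ) t p D mk) : ℕ) : ℤ) ≤ 29 * (((KS0.R'0N κ Φ (KS.NQ Φ) t p D mk) : ℕ) : ℤ) := by nlinarith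
  push_cast
  linarith

/-! ## §3 The root's corridor against (C)'s: same along slot and run length, smaller across window -/

/-- `kgWY WxYR ≤ kgWY WxY`. [folklore] -/
theorem kgWY_R_le (κ : Consts) {V : Type} [DecidableEq V] [Countable V] {G : SimpleGraph V} [G.LocallyFinite] (Φ : PlanarSkeletonFrmQuasi G) (t : V) (p : unitInterval) (D : Skelφ.StepI.DataNS V) (mk : ℕ) (g : ℕ) (f : ℕ) (WxY : ℕ) : (kgWY κ Φ t p D g f (KS.WxYR κ Φ t p D mk g f WxY)) ≤ (kgWY κ Φ t p D g f WxY) := by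
  unfold kgWY KS.WxYR; omega

-- GEN-Q (R-2, captain 2026-08-27): `PlanarSkeletonFrmFrom.NegB.KS.farY_R_le` is not in the used cone of the node top — not ported.

-- GEN-Q (R-2, captain 2026-08-27): `PlanarSkeletonFrmFrom.NegB.KS.farY_R_fits` is not in the used cone of the node top — not ported.

/-- **CREEP MATCHING, upper side**: `kgCtr2Y^C − (2·X2R + kgCtr2Y^R) ≤ n_L + dec₁Y − 1` at every `N` (the windows' east edges coincide; the
`m₁Y` difference costs `2Δm₁·R′0 ≤ n_L` under `40K·R′0 + 1 ≤ n_L`, `WxY ≤ 100·n_L`; `|ΔE₁Y| < dec₁Y`). [this work] -/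
theorem ctr2Y_R_le (κ : Consts) {V : Type} [DecidableEq V] [Countable V] {G : SimpleGraph V} [G.LocallyFinite] (Φ : PlanarSkeletonFrmQuasi G) (t : V) (p : unitInterval) (D : Skelφ.StepI.DataNS V) (mk : ℕ) (g : ℕ) (f : ℕ) (WxY : ℕ) (hN : EqNumL κ Φ t p D g f) (hg : gFloorKG κ Φ t p D mk ≤ g) (hg2 : 40 * Neg.K κ * KS0.R'0N κ Φ (KS.NQ Φ) t p D mk ≤ g) (hWxY : KS.Rs t D mk + 34 * nL κ Φ t p D g f + 29 * KS0.R'0N κ Φ (KS.NQ Φ) t p D mk + 2 ≤ WxY)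
    (hWx : WxY ≤ 100 * nL κ Φ t p D g f) (N : ℕ) :
    (kgCtr2Y (nL κ Φ t p D g f) (vL κ Φ t p D g f) (kgR κ Φ t p D mk) 0 (kgWY κ Φ t p D g f WxY) N) - (2 * (((KS.X2R κ Φ t p D mk g f WxY) : ℕ) : ℤ) + (kgCtr2Y (nL κ Φ t p D g f) (vL κ Φ t p D g f) (kgR κ Φ t p D mk) 0 (kgWY κ Φ t p D g f (KS.WxYR κ Φ t p D mk g f WxY)) N)) ≤ (nL κ Φ t p D g f : ℤ) + (kgDec₁Y (nL κ Φ t p D g f) (kgR κ Φ t p D mk) 0) - 1 := by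
  have HC := kgYRows0_of κ Φ t p D g f mk 0 WxY hN hg
  have HR := kgYRows0_of κ Φ t p D g f mk 0 (KS.WxYR κ Φ t p D mk g f WxY) hN hg
  have hup := HR.kgCtr2Y_sub_le HC N
  have hm := HR.kgM₁Y_sub_mul_le HC N
  have hmono := HR.kgM₁Y_monoW (kgWY_R_le κ Φ t p D mk g f WxY) N
  obtain ⟨-, hsum⟩ := X2R_add_WxYR κ Φ t p D mk g f WxY hWxY
  obtain ⟨hKR, -, -, -, hK, -⟩ := valsQ_floor κ Φ t p D g f mk hN hg hg2
  have hd := HR.dec₁_pos.1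
  have eR : (kgR κ Φ t p D mk) = (KS0.R'0N κ Φ (KS.NQ Φ) t p D mk) := rfl
  have hX2 : (((KS.X2R κ Φ t p D mk g f WxY) : ℕ) : ℤ) ≤ WxY := by
    have := (X2R_add_WxYR κ Φ t p D mk g f WxY hWxY).1
    have : (KS.X2R κ Φ t p D mk g f WxY) ≤ WxY := by omega
    exact_mod_cast this
  have hWx' : ((WxY : ℕ) : ℤ) ≤ 100 * (nL κ Φ t p D g f : ℤ) := by exact_mod_cast hWx
  have hmono' : (((kgM₁Y (nL κ Φ t p D g f) (vL κ Φ t p D g f) (kgR κ Φ t p D mk) 0 (kgWY κ Φ t p D g f (KS.WxYR κ Φ t p D mk g f WxY)) N) : ℕ) : ℤ) ≤ (((kgM₁Y (nL κ Φ t p D g f) (vL κ Φ t p D g f) (kgR κ Φ t p D mk) 0 (kgWY κ Φ t p D g f WxY) N) : ℕ) : ℤ) := by exact_mod_cast hmono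
  have hdec : (kgDec₁Y (nL κ Φ t p D g f) (kgR κ Φ t p D mk) 0) = (nL κ Φ t p D g f : ℤ) - 2 * (((kgR κ Φ t p D mk) : ℕ) : ℤ) - ((0 : ℕ) : ℤ) := rfl
  have hR0 : (0 : ℤ) ≤ (((kgR κ Φ t p D mk) : ℕ) : ℤ) := by positivity
  -- with Δ := m₁^C − m₁^R ≥ 0:  dec₁·Δ ≤ 2(W^C − W^R) + dec₁ − 1 = 2·X2R + dec₁ − 1 ≤ 201·n;  dec₁ ≥ n − 2R′;  1600R′ ≤ n  ⇒  2R′Δ ≤ n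
  have hW2 : 2 * (((((kgWY κ Φ t p D g f WxY) : ℕ) : ℤ)) - (((kgWY κ Φ t p D g f (KS.WxYR κ Φ t p D mk g f WxY)) : ℕ) : ℤ)) = 2 * (((KS.X2R κ Φ t p D mk g f WxY) : ℕ) : ℤ) := by linarith
  have hm' : ((nL κ Φ t p D g f : ℤ) - 2 * (((kgR κ Φ t p D mk) : ℕ) : ℤ)) * ((((kgM₁Y (nL κ Φ t p D g f) (vL κ Φ t p D g f) (kgR κ Φ t p D mk) 0 (kgWY κ Φ t p D g f WxY) N) : ℕ) : ℤ) - (((kgM₁Y (nL κ Φ t p D g f) (vL κ Φ t p D g f) (kgR κ Φ t p D mk) 0 (kgWY κ Φ t p D g f (KS.WxYR κ Φ t p D mk g f WxY)) N) : ℕ) : ℤ)) ≤ 201 * (nL κ Φ t p D g f : ℤ) := by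
    rw [hdec] at hm; push_cast at hm; nlinarith
  have h1600 : 1600 * (((kgR κ Φ t p D mk) : ℕ) : ℤ) + 1 ≤ (nL κ Φ t p D g f : ℤ) := by rw [eR]; nlinarith
  have hprod : 2 * ((((kgR κ Φ t p D mk) : ℕ) : ℤ) * ((((kgM₁Y (nL κ Φ t p D g f) (vL κ Φ t p D g f) (kgR κ Φ t p D mk) 0 (kgWY κ Φ t p D g f WxY) N) : ℕ) : ℤ) - (((kgM₁Y (nL κ Φ t p D g f) (vL κ Φ t p D g f) (kgR κ Φ t p D mk) 0 (kgWY κ Φ t p D g f (KS.WxYR κ Φ t p D mk g f WxY)) N) : ℕ) : ℤ))) ≤ (nL κ Φ t p D g f : ℤ) := by nlinarith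
  rw [hdec] at hup ⊢
  push_cast at hup ⊢
  nlinarith

/-- **CREEP MATCHING, lower side**: `−(dec₁Y − 1) ≤ kgCtr2Y^C − (2·X2R + kgCtr2Y^R)`. [this work] -/
theorem le_ctr2Y_R (κ : Consts) {V : Type} [DecidableEq V] [Countable V] {G : SimpleGraph V} [G.LocallyFinite] (Φ : PlanarSkeletonFrmQuasi G) (t : V) (p : unitInterval) (D : Skelφ.StepI.DataNS V) (mk : ℕ) (g : ℕ) (f : ℕ) (WxY : ℕ) (hN : EqNumL κ Φ t p D g f) (hg : gFloorKG κ Φ t p D mk ≤ g) (hWxY : KS.Rs t D mk + 34 * nL κ Φ t p D g f + 29 * KS0.R'0N κ Φ (KS.NQ Φ) t p D mk + 2 ≤ WxY) (N : ℕ) :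
    -((kgDec₁Y (nL κ Φ t p D g f) (kgR κ Φ t p D mk) 0) - 1) ≤ (kgCtr2Y (nL κ Φ t p D g f) (vL κ Φ t p D g f) (kgR κ Φ t p D mk) 0 (kgWY κ Φ t p D g f WxY) N) - (2 * (((KS.X2R κ Φ t p D mk g f WxY) : ℕ) : ℤ) + (kgCtr2Y (nL κ Φ t p D g f) (vL κ Φ t p D g f) (kgR κ Φ t p D mk) 0 (kgWY κ Φ t p D g f (KS.WxYR κ Φ t p D mk g f WxY)) N)) := by
  have HC := kgYRows0_of κ Φ t p D g f mk 0 WxY hN hg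
  have HR := kgYRows0_of κ Φ t p D g f mk 0 (KS.WxYR κ Φ t p D mk g f WxY) hN hg
  have hlo := HR.le_kgCtr2Y_sub HC N
  obtain ⟨-, hsum⟩ := X2R_add_WxYR κ Φ t p D mk g f WxY hWxY
  have hmono := HR.kgM₁Y_monoW (kgWY_R_le κ Φ t p D mk g f WxY) N
  have hmono' : (((kgM₁Y (nL κ Φ t p D g f) (vL κ Φ t p D g f) (kgR κ Φ t p D mk) 0 (kgWY κ Φ t p D g f (KS.WxYR κ Φ t p D mk g f WxY)) N) : ℕ) : ℤ) ≤ (((kgM₁Y (nL κ Φ t p D g f) (vL κ Φ t p D g f) (kgR κ Φ t p D mk) 0 (kgWY κ Φ t p D g f WxY) N) : ℕ) : ℤ) := by exact_mod_cast hmono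
  have hR0 : (0 : ℤ) ≤ (((kgR κ Φ t p D mk) : ℕ) : ℤ) := by positivity
  have hprod : 0 ≤ 2 * (((((kgM₁Y (nL κ Φ t p D g f) (vL κ Φ t p D g f) (kgR κ Φ t p D mk) 0 (kgWY κ Φ t p D g f WxY) N) : ℕ) : ℤ)) - ((kgM₁Y (nL κ Φ t p D g f) (vL κ Φ t p D g f) (kgR κ Φ t p D mk) 0 (kgWY κ Φ t p D g f (KS.WxYR κ Φ t p D mk g f WxY)) N) : ℕ)) * ((((kgR κ Φ t p D mk) : ℕ) : ℤ) + ((0 : ℕ) : ℤ)) := by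
    push_cast; nlinarith
  linarith

/-- **SPREAD**: `kgHw2Y^R ≤ kgHw2Y^C + dec₁Y − 1`. [this work] -/
theorem hw2Y_R_le (κ : Consts) {V : Type} [DecidableEq V] [Countable V] {G : SimpleGraph V} [G.LocallyFinite] (Φ : PlanarSkeletonFrmQuasi G) (t : V) (p : unitInterval) (D : Skelφ.StepI.DataNS V) (mk : ℕ) (g : ℕ) (f : ℕ) (qxY : ℕ) (WxY : ℕ) (hN : EqNumL κ Φ t p D g f) (hg : gFloorKG κ Φ t p D mk ≤ g) (N : ℕ) :
    (kgHw2Y (nL κ Φ t p D g f) (ℓL κ Φ t p D g f) (hL κ Φ t p D g f) (vL κ Φ t p D g f) (kgR κ Φ t p D mk) 0 (kgqY κ Φ t p D g f qxY) (kgWY κ Φ t p D g f (KS.WxYR κ Φ t p D mk g f WxY)) N) ≤ (kgHw2Y (nL κ Φ t p D g f) (ℓL κ Φ t p D g f) (hL κ Φ t p D g f) (vL κ Φ t p D g f) (kgR κ Φ t p D mk) 0 (kgqY κ Φ t p D g f qxY) (kgWY κ Φ t p D g f WxY) N) + (kgDec₁Y (nL κ Φ t p D g f) (kgR κ Φ t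 p D mk) 0) - 1 :=
  (kgYRows0_of κ Φ t p D g f mk qxY (KS.WxYR κ Φ t p D mk g f WxY) hN hg).kgHw2Y_le_of_le_qW (kgYRows0_of κ Φ t p D g f mk qxY WxY hN hg) le_rfl
    (kgWY_R_le κ Φ t p D mk g f WxY) N

/-- **DEPTH EXTENTS**: `ZY₀^R ≤ ZY₀^C + dec₁Y − 1` and `ZY₁^R ≤ ZY₁^C`. [this work] -/
theorem ZY_R_le (κ : Consts) {V : Type} [DecidableEq V] [Countable V] {G : SimpleGraph V} [G.LocallyFinite] (Φ : PlanarSkeletonFrmQuasi G) (t : V) (p : unitInterval) (D : Skelφ.StepI.DataNS V) (mk : ℕ) (g : ℕ) (f : ℕ) (qxY : ℕ) (WxY : ℕ) (hN : EqNumL κ Φ t p D g f) (hg : gFloorKG κ Φ t p D mk ≤ g) (N : ℕ) :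
    (kgZY₀ (nL κ Φ t p D g f) (vL κ Φ t p D g f) (kgR κ Φ t p D mk) 0 (kgWY κ Φ t p D g f (KS.WxYR κ Φ t p D mk g f WxY)) N (kgM₁Y (nL κ Φ t p D g f) (vL κ Φ t p D g f) (kgR κ Φ t p D mk) 0 (kgWY κ Φ t p D g f (KS.WxYR κ Φ t p D mk g f WxY)) N) (kgWm₂Y (nL κ Φ t p D g f) (vL κ Φ t p D g f) (kgR κ Φ t p D mk) 0 (kgWY κ Φ t p D g f (KS.WxYR κ Φ t p D mk g f WxY)) N) (kgWp₂Y (nL κ Φ t p D g f) (vL κ Φ t p D g f) (kgR κ Φ t p D mk) 0 (kgWY κ Φ t p D g f (KS.WxYR κ Φ t p D mk g f WxY)) N) (kgM₂Y (nL κ Φ t p D g f) (ℓL κ Φ t p D g f) (hL κ Φ t p D g f) (vL κ Φ t p D g f) (kgR κ Φ t p D mk) 0 (kgqY κ Φ t p D g f qxY) (kgWY κ Φ t p D g f (KS.WxYR κ Φ t p D mk g f WxY)) N)) ≤ (kgZY₀ (nL κ Φ t p D g f) (vL κ Φ t p D g f) (kgR κ Φ t p D mk) 0 (kgWY κ Φ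 t p D g f WxY) N (kgM₁Y (nL κ Φ t p D g f) (vL κ Φ t p D g f) (kgR κ Φ t p D mk) 0 (kgWY κ Φ t p D g f WxY) N) (kgWm₂Y (nL κ Φ t p D g f) (vL κ Φ t p D g f) (kgR κ Φ t p D mk) 0 (kgWY κ Φ t p D g f WxY) N) (kgWp₂Y (nL κ Φ t p D g f) (vL κ Φ t p D g f) (kgR κ Φ t p D mk) 0 (kgWY κ Φ t p D g f WxY) N) (kgM₂Y (nL κ Φ t p D g f) (ℓL κ Φ t p D g f) (hL κ Φ t p D g f) (vL κ Φ t p D g f) (kgR κ Φ t p D mk) 0 (kgqY κ Φ t p D g f qxY) (kgWY κ Φ t p D g f WxY) N)) + (kgDec₁Y (nL κ Φ t p D g f) (kgR κ Φ t p D mk) 0) - 1 ∧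
    (kgZY₁ (nL κ Φ t p D g f) (ℓL κ Φ t p D g f) (hL κ Φ t p D g f) (kgR κ Φ t p D mk) 0 (kgqY κ Φ t p D g f qxY) N (kgM₁Y (nL κ Φ t p D g f) (vL κ Φ t p D g f) (kgR κ Φ t p D mk) 0 (kgWY κ Φ t p D g f (KS.WxYR κ Φ t p D mk g f WxY)) N) (kgM₂Y (nL κ Φ t p D g f) (ℓL κ Φ t p D g f) (hL κ Φ t p D g f) (vL κ Φ t p D g f) (kgR κ Φ t p D mk) 0 (kgqY κ Φ t p D g f qxY) (kgWY κ Φ t p D g f (KS.WxYR κ Φ t p D mk g f WxY)) N)) ≤ (kgZY₁ (nL κ Φ t p D g f) (ℓL κ Φ t p D g f) (hL κ Φ t p D g f) (kgR κ Φ t p D mk) 0 (kgqY κ Φ t p D g f qxY) N (kgM₁Y (nL κ Φ t p D g f) (vL κ Φ t p D g f) (kgR κ Φ t p D mk) 0 (kgWY κ Φ t p D g f WxY) N) (kgM₂Y (nL κ Φ t p D g f) (ℓL κ Φ t p D g f) (hL κ Φ t p D g f) (vL κ Φ t p D g f) (kgR κ Φ t p D mk) 0 (kgqY κ Φ t p D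 g f qxY) (kgWY κ Φ t p D g f WxY) N)) := by
  have HC := kgYRows0_of κ Φ t p D g f mk qxY WxY hN hg
  have HR := kgYRows0_of κ Φ t p D g f mk qxY (KS.WxYR κ Φ t p D mk g f WxY) hN hg
  exact ⟨HR.kgZY₀_le_of_le_qW HC le_rfl (kgWY_R_le κ Φ t p D mk g f WxY) N, HR.kgZY₁_mono_qW le_rfl (kgWY_R_le κ Φ t p D mk g f WxY) N⟩

/-- **LENGTH**: the root's y′-schedule is at most as long as (C)'s at every run length. [this work] -/
theorem schedLenY_R_le (κ : Consts) {V : Type} [DecidableEq V] [Countable V] {G : SimpleGraph V} [G.LocallyFinite] (Φ : PlanarSkeletonFrmQuasi G) (t : V) (p : unitInterval) (D : Skelφ.StepI.DataNS V) (mk : ℕ) (g : ℕ) (f : ℕ) (qxY : ℕ) (WxY : ℕ) (hN : EqNumL κ Φ t p D g f) (hg : gFloorKG κ Φ t p D mk ≤ g) (N : ℕ) :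
    N + 1 + ((kgM₁Y (nL κ Φ t p D g f) (vL κ Φ t p D g f) (kgR κ Φ t p D mk) 0 (kgWY κ Φ t p D g f (KS.WxYR κ Φ t p D mk g f WxY)) N) + 1) + ((kgM₂Y (nL κ Φ t p D g f) (ℓL κ Φ t p D g f) (hL κ Φ t p D g f) (vL κ Φ t p D g f) (kgR κ Φ t p D mk) 0 (kgqY κ Φ t p D g f qxY) (kgWY κ Φ t p D g f (KS.WxYR κ Φ t p D mk g f WxY)) N) + 1) ≤ N + 1 + ((kgM₁Y (nL κ Φ t p D g f) (vL κ Φ t p D g f) (kgR κ Φ t p D mk) 0 (kgWY κ Φ t p D g f WxY) N) + 1) + ((kgM₂Y (nL κ Φ t p D g f) (ℓL κ Φ t p D g f) (hL κ Φ t p D g f) (vL κ Φ t p D g f) (kgR κ Φ t p D mk) 0 (kgqY κ Φ t p D g f qxY) (kgWY κ Φ t p D g f WxY) N) + 1) :=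
  (kgYRows0_of κ Φ t p D g f mk qxY (KS.WxYR κ Φ t p D mk g f WxY) hN hg).kgSchedLenY_mono_qW le_rfl (kgWY_R_le κ Φ t p D mk g f WxY) N

-- GEN-Q (R-2, captain 2026-08-27): `PlanarSkeletonFrmFrom.NegB.KS.kgSchedNRY_le_LfQ3` is not in the used cone of the node top — not ported.

end Rows

end KS

end NegB

end PlanarSkeletonFrmQuasi

end Summit.CriticalPhenomena.PercolationContinuityZ3.Theorems.Transplant

end
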